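/-
Copyright (c) 2026 the pub-hodgecm-mathlib formalisation cell (harness21).  Prover seat hodgecm-mathlib-A-p13 (g38), line LD1
(`Cruxes/HLiu418/Lines/F0_P6LD_StubS1FactsThetaRoad`, organ (L) «line pin», brick (L-T0)), 2026-09-02.  KERNEL module:
THEOREMS ONLY (no definition, no named fact, no instance, no notation, no `sorry`).
-/
import Literature.NumberTheory.Automorphic.Liu2021.ThetaLiftFromLineCharacters
import HarnessLib

-- As in the lineage (`ThetaLiftFromLineCharacters`): statements over the theta-kernel datum elaborate to very large
-- types; elaborate sequentially.
set_option Elab.async false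

/-!
# Transport of the seam `MeetsThetaLiftFromLine` along an intertwined pair of line data (brick (L-T0) of LD1 organ (L))

Topic `NumberTheory/Automorphic/Liu2021`; namespace `Literature.NumberTheory.Automorphic.Liu2021` (§2) and
`Literature.NumberTheory.GelbartRogawski1991.UnitaryDualPair` (§1).  THEOREMS ONLY.  Cell hodgecm-mathlib FLOOR 0,
crux `HLiu418` (stmt-HodgeConjecture-24832), socket 27458 `F0_AlbCm.stub_S1_facts` (#73), LD1 in-house θ-road
(`F0/P6/LD/LD1-plan/g0/StubS1facts.inhouse.skeleton.v5.lean`, organ (L) `ThetaLinePinned₂`, [Liu2021, Thm. B.4 (2),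
proof of Cor. B.6 (3) p. 99 L41–46]): after the local–global line pin «`a″/a′ ∈ N(L^×)`» (L-D) the theta classes of `P′`
from the line `⟨a″⟩` must be READ as theta classes from `⟨a′⟩` (L-T).  In the tree's currency the symplectic model of the
pair `U(diag d_V) × U(⟨a⟩)` sees the line only through the Kronecker Gram `diag d_V ⊗ (a)`, and every change of line ∕ frame
is an IDENTITY OF WEIL OPERATORS `R ∘ ω′(s′_pair(k, u)) = ω(s_pair(θ_V k, θ_W u)) ∘ R` with `R` a `Θ`-FIXING operator
(Weil's rational lift, [Weil1964, n° 41 Thm. 6]; the tree's ★ `hω_of_T4` for rational V-isometries).  THIS FILE is the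
CONSUMER HALF, once and for all: such an identity transports the seam.

* §1 `thetaKernelDatum_thetaFun_eq_of_intertwiner` — GENERIC unitary dual pairs `(J_V′, J_W′)`, `(J_V, J_W)` over `E/F`:
  from `Θ ∘ R = Θ′` and `R (ω′(s′_pair p) Φ) = ω(s_pair (θ p)) (R Φ)`, the theta KERNELS agree:
  `θ′_Φ(x, h) = θ_{RΦ}(θ_V x, θ_W h)` ([Weil1964, n° 41]; [GelbartRogawski1991, §3.2] `θ_Φ(g,h) = Σ_ξ (ω(s(g,h))Φ)(ξ)`).
* §2 `MeetsThetaLiftFromLine.transport` — CM line data `(d_V′, a′)`, `(d_V, a)` (ranks `N′`, `N`, any enumerations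
  `e₁′`, `e₁`), `θ_V : U(diag d_V′)(𝔸) →* U(diag d_V)(𝔸)`, `θ_W : U(⟨a′⟩)(𝔸) ≃* U(⟨a⟩)(𝔸)` bicontinuous with
  `θ_W(U(⟨a′⟩)(L⁺)) = U(⟨a⟩)(L⁺)`, and `R` as above at the `μ`-attached splittings:
  `MeetsThetaLiftFromLine … d_V′ … P μ hμ a′ ιA′ → MeetsThetaLiftFromLine … d_V … P μ hμ a (θ_V ∘ ιA′)` — the witnesses move
  as `(μ_W ↦ (θ̄_W)_* μ_W, f ↦ f ∘ θ̄_W⁻¹, Φ ↦ R Φ)` and the theta LIFTS agree pointwise on `U(H)(𝔸)`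
  (`thetaLiftFun′ μ_W Φ f x = thetaLiftFun ((θ̄_W)_* μ_W) (RΦ) (f ∘ θ̄_W⁻¹) (θ_V x)`, change of variables on `[U(⟨a′⟩)] ≃ₜ [U(⟨a⟩)]`).

HONEST SCOPE.  Nothing of [Liu2021] is asserted; the operator identities themselves ((L-T1) W-rescaling `(d_V, a·c) ≡ (c•d_V, a)`,
(L-T2) V-frame change along a rational isometry, from ★ `DoubledKroneckerConjugationOmega.hω_of_T4`) are NOT here.  HC_CM is proved
only modulo the printed citations (2 remaining named inputs hLiu418 24832, h413 24833) until rung 0 closes; count-neutral.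

## References
* [Weil1964] A. Weil, *Sur certains groupes d'opérateurs unitaires*, Acta Math. 111 (1964), Chap. III n° 41, Thm. 6 p. 193.
* [GelbartRogawski1991] S. Gelbart, J. Rogawski, Invent. Math. 105 (1991), §3.1 Remark p. 457; §3.2 p. 457.
* [Liu2021] Y. Liu, Camb. J. Math. 9 (2021) = arXiv:2102.11518, Thm. B.4 (2) p. 98; proof of Cor. B.6 (3) p. 99 L41–46;
  App. D §D.1 Step 1 (l. 5215: «the isomorphism class of `ω(μ, ε, χ)` depends only on `(μ, ε, χ)`»).
* [FleigEtAl2018] P. Fleig, H. Gustafsson, A. Kleinschmidt, D. Persson, CUP (2018), §12.3 Def. 12.5 (12.37) p. 296.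
-/

set_option autoImplicit false

noncomputable section

open NumberField MeasureTheory IsDedekindDomain
open scoped Matrix ComplexOrder ENNReal

/-! ## §1 Generic dual pairs: the theta kernels agree along a `Θ`-fixing intertwiner -/

namespace Literature.NumberTheory.GelbartRogawski1991.UnitaryDualPair

open _root_.MeasureTheory
open Literature.NumberTheory.Automorphic
open Literature.NumberTheory.Weil1964
open Literature.RepresentationTheory.HeisenbergGroup

section Kernel

variable {F E : Type} [Field F] [NumberField F] [Field E] [NumberField E] [Algebra F E]
  {c : E ≃ₐ[F] E} {N M N' M' : ℕ} {n n' : ℕ} {e : Fin N × Fin M ≃ Fin n} {e' : Fin N' × Fin M' ≃ Fin n'}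
  {JV : Matrix (Fin N) (Fin N) E} {JW : Matrix (Fin M) (Fin M) E}
  {JV' : Matrix (Fin N') (Fin N') E} {JW' : Matrix (Fin M') (Fin M') E}
  {TV : Matrix (Fin N) (Fin N) F} {TW : Matrix (Fin M) (Fin M) F}
  {TV' : Matrix (Fin N') (Fin N') F} {TW' : Matrix (Fin M') (Fin M') F}
  [Algebra.IsQuadraticExtension F E] {δ : E} {hcδ : c δ = -δ} {hδ : δ ≠ 0} {d : F} {hd : δ * δ = algebraMap F E d}
  {hV : TV.IsSymm} {hW : TW.IsSymm} {hVd : IsUnit TV.det} {hWd : IsUnit TW.det}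
  {hJV : JV = TV.map (algebraMap F E)} {hJW : JW = TW.map (algebraMap F E)}
  {hV' : TV'.IsSymm} {hW' : TW'.IsSymm} {hVd' : IsUnit TV'.det} {hWd' : IsUnit TW'.det}
  {hJV' : JV' = TV'.map (algebraMap F E)} {hJW' : JW' = TW'.map (algebraMap F E)}
  [LocallyCompactSpace (UnitaryGroup.adelic F E c N JV)] [LocallyCompactSpace (UnitaryGroup.adelic F E c M JW)]
  [LocallyCompactSpace (UnitaryGroup.adelic F E c N' JV')] [LocallyCompactSpace (UnitaryGroup.adelic F E c M' JW')]
  {s : UnitaryGroup.adelicPair F E c N M JV JW →* adelicMpCont F (Fin n) (adelicGram F e TV TW)}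
  {hs : (splittingDatum F E c N M e JV JW hcδ hδ hd hV hW hVd hWd hJV hJW).IsCompatible s}
  {hρ : HasThetaMajorants fun (p : UnitaryGroup.adelic F E c N JV × UnitaryGroup.adelic F E c M JW)
    (Φ : piSchwartzBruhat F (Fin n)) => pairRep F E c N M e JV JW s p Φ}
  {SK : Set (piSchwartzBruhat F (Fin n))}
  {hSK : ∀ (h : UnitaryGroup.adelic F E c M JW) (Φ : piSchwartzBruhat F (Fin n)), Φ ∈ SK →
    pairRep F E c N M e JV JW s (1, h) Φ ∈ SK}
  {s' : UnitaryGroup.adelicPair F E c N' M' JV' JW' →* adelicMpCont F (Fin n') (adelicGram F e' TV' TW')}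
  {hs' : (splittingDatum F E c N' M' e' JV' JW' hcδ hδ hd hV' hW' hVd' hWd' hJV' hJW').IsCompatible s'}
  {hρ' : HasThetaMajorants fun (p : UnitaryGroup.adelic F E c N' JV' × UnitaryGroup.adelic F E c M' JW')
    (Φ : piSchwartzBruhat F (Fin n')) => pairRep F E c N' M' e' JV' JW' s' p Φ}
  {SK' : Set (piSchwartzBruhat F (Fin n'))}
  {hSK' : ∀ (h : UnitaryGroup.adelic F E c M' JW') (Φ : piSchwartzBruhat F (Fin n')), Φ ∈ SK' →
    pairRep F E c N' M' e' JV' JW' s' (1, h) Φ ∈ SK'}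

/-- **The theta kernels of two unitary dual pairs agree along a `Θ`-fixing intertwiner.**  If `R : 𝒮(𝔸_F^{n′}) → 𝒮(𝔸_F^{n})`
is linear with `Θ(R Ψ) = Θ(Ψ)` and `R (ω′(s′_pair(k, u)) Φ) = ω(s_pair(θ_V k, θ_W u)) (R Φ)` for homomorphisms `θ_V`, `θ_W` of
the adelic unitary groups (any `MonoidHomClass`: plain homomorphisms, isomorphisms), then `θ′_Φ(x, h) = θ_{RΦ}(θ_V x, θ_W h)` — `θ_Φ(x, h) = Θ(ω(s_pair(x⁻¹, h⁻¹)) Φ)` on both sides.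
[cite: Weil1964, Chap. III n° 41 Thm 6 p. 193] [cite: GelbartRogawski1991, §3.2 p. 457] -/
theorem thetaKernelDatum_thetaFun_eq_of_intertwiner
    {FV FW : Type*} [FunLike FV (UnitaryGroup.adelic F E c N' JV') (UnitaryGroup.adelic F E c N JV)]
    [MonoidHomClass FV (UnitaryGroup.adelic F E c N' JV') (UnitaryGroup.adelic F E c N JV)]
    [FunLike FW (UnitaryGroup.adelic F E c M' JW') (UnitaryGroup.adelic F E c M JW)]
    [MonoidHomClass FW (UnitaryGroup.adelic F E c M' JW') (UnitaryGroup.adelic F E c M JW)] (θV : FV) (θW : FW)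
    (R : piSchwartzBruhat F (Fin n') →ₗ[ℂ] piSchwartzBruhat F (Fin n))
    (hΘ : ∀ Ψ : piSchwartzBruhat F (Fin n'), thetaDistLM F (Fin n) (R Ψ) = thetaDistLM F (Fin n') Ψ)
    (hR : ∀ (k : UnitaryGroup.adelic F E c N' JV') (u : UnitaryGroup.adelic F E c M' JW') (Φ : piSchwartzBruhat F (Fin n')),
      R (pairRep F E c N' M' e' JV' JW' s' (k, u) Φ) = pairRep F E c N M e JV JW s (θV k, θW u) (R Φ))
    (Φ : piSchwartzBruhat F (Fin n')) (x : UnitaryGroup.adelic F E c N' JV') (h : UnitaryGroup.adelic F E c M' JW') :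
    (thetaKernelDatum F E c N' M' e' JV' JW' hcδ hδ hd hV' hW' hVd' hWd' hJV' hJW' s' hs' hρ' SK' hSK').thetaFun Φ (x, h) =
      (thetaKernelDatum F E c N M e JV JW hcδ hδ hd hV hW hVd hWd hJV hJW s hs hρ SK hSK).thetaFun (R Φ) (θV x, θW h) := by
  have h1 : (thetaKernelDatum F E c N' M' e' JV' JW' hcδ hδ hd hV' hW' hVd' hWd' hJV' hJW' s' hs' hρ' SK' hSK').thetaFun Φ (x, h) =
      thetaDistLM F (Fin n') (pairRep F E c N' M' e' JV' JW' s' (x⁻¹, h⁻¹) Φ) :=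
    thetaKernelDatum_thetaFun_mk F E c N' M' e' JV' JW' hcδ hδ hd hV' hW' hVd' hWd' hJV' hJW' hs' hρ' SK' hSK' Φ x h
  have h2 : (thetaKernelDatum F E c N M e JV JW hcδ hδ hd hV hW hVd hWd hJV hJW s hs hρ SK hSK).thetaFun (R Φ) (θV x, θW h) =
      thetaDistLM F (Fin n) (pairRep F E c N M e JV JW s ((θV x)⁻¹, (θW h)⁻¹) (R Φ)) :=
    thetaKernelDatum_thetaFun_mk F E c N M e JV JW hcδ hδ hd hV hW hVd hWd hJV hJW hs hρ SK hSK (R Φ) (θV x) (θW h)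
  have hx : θV x⁻¹ = (θV x)⁻¹ := map_inv θV x
  have hh : θW h⁻¹ = (θW h)⁻¹ := map_inv θW h
  have key : R (pairRep F E c N' M' e' JV' JW' s' (x⁻¹, h⁻¹) Φ) = pairRep F E c N M e JV JW s ((θV x)⁻¹, (θW h)⁻¹) (R Φ) := by
    have k := hR x⁻¹ h⁻¹ Φ
    rw [hx, hh] at k
    exact k
  exact h1.trans (((hΘ _).symm.trans (congrArg (thetaDistLM F (Fin n)) key)).trans h2.symm)

end Kernel

end Literature.NumberTheory.GelbartRogawski1991.UnitaryDualPair

/-! ## §2 The CM line: transport of the seam `MeetsThetaLiftFromLine` -/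

namespace Literature.NumberTheory.Automorphic.Liu2021

open _root_.MeasureTheory
open Literature.NumberTheory.Automorphic Literature.NumberTheory.Automorphic.UnitaryGroup
open Literature.NumberTheory.Automorphic.UnitaryGroup.CotangentForms
open Literature.NumberTheory.Automorphic.IdeleClassGroup
open Literature.NumberTheory.Automorphic.Liu2021.Def411WeilCarriers
open Literature.NumberTheory.Automorphic.Liu2021.Def411WeilCarriersDoubling
open Literature.NumberTheory.GelbartRogawski1991 Literature.NumberTheory.GelbartRogawski1991.UnitaryDualPair
open Literature.NumberTheory.Weil1964
open Literature.RepresentationTheory.Liu2021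
open Literature.RepresentationTheory.HeisenbergGroup

section Seam

variable (L : Type) [Field L] [NumberField L] [IsCMField L] (N : ℕ) (H : Matrix (Fin N) (Fin N) L)
  {n₁ n₂ : ℕ} (e₁' : Fin N × Fin 1 ≃ Fin n₁) (e₁ : Fin N × Fin 1 ≃ Fin n₂)
  (dV' : Fin N → L) (hdV' : ∀ i, IsCMField.complexConj L (dV' i) = dV' i) (hdV'0 : ∀ i, dV' i ≠ 0)
  (dV : Fin N → L) (hdV : ∀ i, IsCMField.complexConj L (dV i) = dV i) (hdV0 : ∀ i, dV i ≠ 0)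
  {μA : Measure (adelicGroupData (↥(maximalRealSubfield L)) L (IsCMField.complexConj L) N H).automorphicQuotient}
  [(adelicGroupData (↥(maximalRealSubfield L)) L (IsCMField.complexConj L) N H).IsAutomorphicMeasure μA]
  (μ : Literature.NumberTheory.Automorphic.IdeleClassGroup L →ₜ* Circle) (hμ : IsConjugateSymplectic L μ)
  (a' a : (↥(maximalRealSubfield L))ˣ)

set_option maxHeartbeats 800000 in -- measured: fails at 200 000 (two line telescopes compared in `isDefEq`)
/-- **TRANSPORT OF THE SEAM along an intertwined pair of line data** (brick (L-T0) of LD1 organ (L)).  Two line data at the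
`μ`-attached splittings — `(d_V′, ⟨a′⟩)` with model `𝒮(𝔸^{n₁})` and `(d_V, ⟨a⟩)` with model `𝒮(𝔸^{n₂})` —, a homomorphism
`θ_V : U(diag d_V′)(𝔸) →* U(diag d_V)(𝔸)`, a bicontinuous isomorphism `θ_W : U(⟨a′⟩)(𝔸) ≃* U(⟨a⟩)(𝔸)` with
`θ_W(U(⟨a′⟩)(L⁺)) = U(⟨a⟩)(L⁺)`, and a linear `R : 𝒮(𝔸^{n₁}) → 𝒮(𝔸^{n₂})` FIXING THE THETA DISTRIBUTION (`Θ ∘ R = Θ`) and INTERTWINING the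
two pair representations (`R (ω′(s′_pair(k, u)) Φ) = ω(s_pair(θ_V k, θ_W u)) (R Φ)`): if the discrete automorphic `P` meets the theta lift from
`⟨a′⟩` along `ιA′` then it meets the theta lift from `⟨a⟩` along `θ_V ∘ ιA′` (given Weil's majorants at the target, ★
`hasThetaMajorants_lineThetaKernelDatum`).  The theta LIFTS agree pointwise: `Θ̃′_Φ(f)(x) = Θ̃_{RΦ}(f ∘ θ̄_W⁻¹)(θ_V x)` for the pushed-forward
measure on `[U(⟨a⟩)] ≃ₜ [U(⟨a′⟩)]` (§1 + change of variables), so the `L²`-class in `P` is literally the same.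
[cite: Weil1964, Chap. III n° 41 Thm 6 p. 193] [cite: GelbartRogawski1991, §3.1 Remark p. 457; §3.2 p. 457]
[cite: Liu2021, Thm. B.4 (2) p. 98; proof of Cor. B.6 (3) p. 99 L41–46; App. D §D.1 Step 1 (l. 5215)] [cite: FleigEtAl2018, §12.3 Def. 12.5 (12.37) p. 296] -/
theorem MeetsThetaLiftFromLine.transport
    (θV : ↥(UnitaryGroup.adelic (↥(maximalRealSubfield L)) L (IsCMField.complexConj L) N (Matrix.diagonal dV')) →*
      ↥(UnitaryGroup.adelic (↥(maximalRealSubfield L)) L (IsCMField.complexConj L) N (Matrix.diagonal dV)))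
    (θW : ↥(UnitaryGroup.adelic (↥(maximalRealSubfield L)) L (IsCMField.complexConj L) 1 (JW (↥(maximalRealSubfield L)) L a')) ≃*
      ↥(UnitaryGroup.adelic (↥(maximalRealSubfield L)) L (IsCMField.complexConj L) 1 (JW (↥(maximalRealSubfield L)) L a)))
    (hθWc : Continuous θW) (hθWc' : Continuous θW.symm)
    (hΓ : ((UnitaryGroup.toAdelic (↥(maximalRealSubfield L)) L (IsCMField.complexConj L) 1 (JW (↥(maximalRealSubfield L)) L a')).range).map
        (θW : ↥(UnitaryGroup.adelic (↥(maximalRealSubfield L)) L (IsCMField.complexConj L) 1 (JW (↥(maximalRealSubfield L)) L a')) →*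
          ↥(UnitaryGroup.adelic (↥(maximalRealSubfield L)) L (IsCMField.complexConj L) 1 (JW (↥(maximalRealSubfield L)) L a))) =
      (UnitaryGroup.toAdelic (↥(maximalRealSubfield L)) L (IsCMField.complexConj L) 1 (JW (↥(maximalRealSubfield L)) L a)).range)
    (R : piSchwartzBruhat (↥(maximalRealSubfield L)) (Fin n₁) →ₗ[ℂ] piSchwartzBruhat (↥(maximalRealSubfield L)) (Fin n₂))
    (hΘ : ∀ Ψ : piSchwartzBruhat (↥(maximalRealSubfield L)) (Fin n₁),
      thetaDistLM (↥(maximalRealSubfield L)) (Fin n₂) (R Ψ) = thetaDistLM (↥(maximalRealSubfield L)) (Fin n₁) Ψ)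
    (hR : ∀ (k : ↥(UnitaryGroup.adelic (↥(maximalRealSubfield L)) L (IsCMField.complexConj L) N (Matrix.diagonal dV')))
      (u : ↥(UnitaryGroup.adelic (↥(maximalRealSubfield L)) L (IsCMField.complexConj L) 1 (JW (↥(maximalRealSubfield L)) L a')))
      (Φ : piSchwartzBruhat (↥(maximalRealSubfield L)) (Fin n₁)),
      R (pairRep (↥(maximalRealSubfield L)) L (IsCMField.complexConj L) N 1 e₁' (Matrix.diagonal dV') (JW (↥(maximalRealSubfield L)) L a')
          (chiSplittingLine L e₁' dV' hdV' hdV'0 (toHeckeCharacter L μ) (isUnitary_toHeckeCharacter L μ)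
            ((isOscillatorChar_toHeckeCharacter_iff μ).mpr hμ) (TW (↥(maximalRealSubfield L)) a')
            (isUnit_det_TW (↥(maximalRealSubfield L)) a') (JW (↥(maximalRealSubfield L)) L a') (JW_eq (↥(maximalRealSubfield L)) L a'))
          (k, u) Φ) =
        pairRep (↥(maximalRealSubfield L)) L (IsCMField.complexConj L) N 1 e₁ (Matrix.diagonal dV) (JW (↥(maximalRealSubfield L)) L a)
          (chiSplittingLine L e₁ dV hdV hdV0 (toHeckeCharacter L μ) (isUnitary_toHeckeCharacter L μ)
            ((isOscillatorChar_toHeckeCharacter_iff μ).mpr hμ) (TW (↥(maximalRealSubfield L)) a)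
            (isUnit_det_TW (↥(maximalRealSubfield L)) a) (JW (↥(maximalRealSubfield L)) L a) (JW_eq (↥(maximalRealSubfield L)) L a))
          (θV k, θW u) (R Φ))
    (hρ : HasThetaMajorants fun
      (p : ↥(UnitaryGroup.adelic (↥(maximalRealSubfield L)) L (IsCMField.complexConj L) N (Matrix.diagonal dV)) ×
        ↥(UnitaryGroup.adelic (↥(maximalRealSubfield L)) L (IsCMField.complexConj L) 1 (JW (↥(maximalRealSubfield L)) L a)))
      (Φ : piSchwartzBruhat (↥(maximalRealSubfield L)) (Fin n₂)) =>
        pairRep (↥(maximalRealSubfield L)) L (IsCMField.complexConj L) N 1 e₁ (Matrix.diagonal dV) (JW (↥(maximalRealSubfield L)) L a)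
          (chiSplittingLine L e₁ dV hdV hdV0 (toHeckeCharacter L μ) (isUnitary_toHeckeCharacter L μ)
            ((isOscillatorChar_toHeckeCharacter_iff μ).mpr hμ) (TW (↥(maximalRealSubfield L)) a)
            (isUnit_det_TW (↥(maximalRealSubfield L)) a) (JW (↥(maximalRealSubfield L)) L a) (JW_eq (↥(maximalRealSubfield L)) L a))
          p Φ)
    [CompactSpace (↥(UnitaryGroup.adelic (↥(maximalRealSubfield L)) L (IsCMField.complexConj L) N (Matrix.diagonal dV')) ⧸
      (UnitaryGroup.toAdelic (↥(maximalRealSubfield L)) L (IsCMField.complexConj L) N (Matrix.diagonal dV')).range)]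
    [CompactSpace (↥(UnitaryGroup.adelic (↥(maximalRealSubfield L)) L (IsCMField.complexConj L) N (Matrix.diagonal dV)) ⧸
      (UnitaryGroup.toAdelic (↥(maximalRealSubfield L)) L (IsCMField.complexConj L) N (Matrix.diagonal dV)).range)]
    (P : DiscreteAutomorphicRep (adelicGroupData (↥(maximalRealSubfield L)) L (IsCMField.complexConj L) N H) μA)
    (ιA' : (adelicGroupData (↥(maximalRealSubfield L)) L (IsCMField.complexConj L) N H).Adelic →*
      ↥(UnitaryGroup.adelic (↥(maximalRealSubfield L)) L (IsCMField.complexConj L) N (Matrix.diagonal dV')))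
    (h : MeetsThetaLiftFromLine L N H e₁' dV' hdV' hdV'0 P μ hμ a' ιA') :
    MeetsThetaLiftFromLine L N H e₁ dV hdV hdV0 P μ hμ a (θV.comp ιA') := by
  classical
  haveI hN' := normal_range_toAdelic_JW L a'
  haveI hN := normal_range_toAdelic_JW L a
  haveI hcW' := compactSpace_quotient_range_toAdelic_JW L a'
  haveI hcW := compactSpace_quotient_range_toAdelic_JW L a
  letI mW' : MeasurableSpace (↥(UnitaryGroup.adelic (↥(maximalRealSubfield L)) L (IsCMField.complexConj L) 1
      (JW (↥(maximalRealSubfield L)) L a')) ⧸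
        (UnitaryGroup.toAdelic (↥(maximalRealSubfield L)) L (IsCMField.complexConj L) 1 (JW (↥(maximalRealSubfield L)) L a')).range) :=
    borel _
  haveI bW' : BorelSpace (↥(UnitaryGroup.adelic (↥(maximalRealSubfield L)) L (IsCMField.complexConj L) 1
      (JW (↥(maximalRealSubfield L)) L a')) ⧸
        (UnitaryGroup.toAdelic (↥(maximalRealSubfield L)) L (IsCMField.complexConj L) 1 (JW (↥(maximalRealSubfield L)) L a')).range) :=
    ⟨rfl⟩
  letI mW : MeasurableSpace (↥(UnitaryGroup.adelic (↥(maximalRealSubfield L)) L (IsCMField.complexConj L) 1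
      (JW (↥(maximalRealSubfield L)) L a)) ⧸
        (UnitaryGroup.toAdelic (↥(maximalRealSubfield L)) L (IsCMField.complexConj L) 1 (JW (↥(maximalRealSubfield L)) L a)).range) :=
    borel _
  haveI bW : BorelSpace (↥(UnitaryGroup.adelic (↥(maximalRealSubfield L)) L (IsCMField.complexConj L) 1
      (JW (↥(maximalRealSubfield L)) L a)) ⧸
        (UnitaryGroup.toAdelic (↥(maximalRealSubfield L)) L (IsCMField.complexConj L) 1 (JW (↥(maximalRealSubfield L)) L a)).range) :=
    ⟨rfl⟩
  obtain ⟨hρ', μW', hfin', hinv', f', Φ', hθ', hmem, hne⟩ := h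
  haveI := hfin'
  haveI := hinv'
  -- the quotient isomorphism `θ̄_W : [U(⟨a′⟩)] ≃ [U(⟨a⟩)]`, bicontinuous and equivariant
  let eq := QuotientGroup.congr
    (UnitaryGroup.toAdelic (↥(maximalRealSubfield L)) L (IsCMField.complexConj L) 1 (JW (↥(maximalRealSubfield L)) L a')).range
    (UnitaryGroup.toAdelic (↥(maximalRealSubfield L)) L (IsCMField.complexConj L) 1 (JW (↥(maximalRealSubfield L)) L a)).range θW hΓ
  have heq_mk : ∀ u, eq (QuotientGroup.mk u) = QuotientGroup.mk (θW u) := fun u => QuotientGroup.congr_mk _ _ θW hΓ u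
  have heq_symm_mk : ∀ v, eq.symm (QuotientGroup.mk v) = QuotientGroup.mk (θW.symm v) := fun v => by
    rw [MulEquiv.symm_apply_eq, heq_mk, MulEquiv.apply_symm_apply]
  have hceq : Continuous eq := by
    rw [(QuotientGroup.isQuotientMap_mk _).continuous_iff]
    have hc : (eq : _ → _) ∘ QuotientGroup.mk = QuotientGroup.mk ∘ θW := funext heq_mk
    rw [hc]
    exact continuous_quotient_mk'.comp hθWc
  have hceq' : Continuous eq.symm := by
    rw [(QuotientGroup.isQuotientMap_mk _).continuous_iff]
    have hc : (eq.symm : _ → _) ∘ QuotientGroup.mk = QuotientGroup.mk ∘ θW.symm := funext heq_symm_mk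
    rw [hc]
    exact continuous_quotient_mk'.comp hθWc'
  let eh : (↥(UnitaryGroup.adelic (↥(maximalRealSubfield L)) L (IsCMField.complexConj L) 1 (JW (↥(maximalRealSubfield L)) L a')) ⧸
        (UnitaryGroup.toAdelic (↥(maximalRealSubfield L)) L (IsCMField.complexConj L) 1 (JW (↥(maximalRealSubfield L)) L a')).range) ≃ₜ
      (↥(UnitaryGroup.adelic (↥(maximalRealSubfield L)) L (IsCMField.complexConj L) 1 (JW (↥(maximalRealSubfield L)) L a)) ⧸
        (UnitaryGroup.toAdelic (↥(maximalRealSubfield L)) L (IsCMField.complexConj L) 1 (JW (↥(maximalRealSubfield L)) L a)).range) :=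
    { eq.toEquiv with continuous_toFun := hceq, continuous_invFun := hceq' }
  have heh : ∀ q, eh q = eq q := fun _ => rfl
  have heh_symm : ∀ q, eh.symm q = eq.symm q := fun _ => rfl
  have heh_smul : ∀ (g : ↥(UnitaryGroup.adelic (↥(maximalRealSubfield L)) L (IsCMField.complexConj L) 1 (JW (↥(maximalRealSubfield L)) L a')))
      (q : ↥(UnitaryGroup.adelic (↥(maximalRealSubfield L)) L (IsCMField.complexConj L) 1 (JW (↥(maximalRealSubfield L)) L a')) ⧸
        (UnitaryGroup.toAdelic (↥(maximalRealSubfield L)) L (IsCMField.complexConj L) 1 (JW (↥(maximalRealSubfield L)) L a')).range),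
      eh (g • q) = θW g • eh q := fun g q => by
    induction q using QuotientGroup.induction_on with
    | H u => rw [MulAction.Quotient.smul_mk, smul_eq_mul, heh, heh, heq_mk, heq_mk, map_mul, MulAction.Quotient.smul_mk, smul_eq_mul]
  let em := eh.toMeasurableEquiv
  have hem : ∀ q, em q = eh q := fun q => congrFun (Homeomorph.toMeasurableEquiv_coe eh) q
  -- the pushed-forward measure and the transported weight
  let μW := μW'.map em
  haveI hfin : IsFiniteMeasure μW := Measure.isFiniteMeasure_map μW' em
  have hinv : SMulInvariantMeasure
      (↥(UnitaryGroup.adelic (↥(maximalRealSubfield L)) L (IsCMField.complexConj L) 1 (JW (↥(maximalRealSubfield L)) L a)))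
      (↥(UnitaryGroup.adelic (↥(maximalRealSubfield L)) L (IsCMField.complexConj L) 1 (JW (↥(maximalRealSubfield L)) L a)) ⧸
        (UnitaryGroup.toAdelic (↥(maximalRealSubfield L)) L (IsCMField.complexConj L) 1 (JW (↥(maximalRealSubfield L)) L a)).range) μW := by
    refine ⟨fun g s hs => ?_⟩
    show μW'.map em ((fun q => g • q) ⁻¹' s) = μW'.map em s
    rw [MeasurableEquiv.map_apply, MeasurableEquiv.map_apply]
    have hset : (em : _ → _) ⁻¹' ((fun q => g • q) ⁻¹' s) = (fun q' => θW.symm g • q') ⁻¹' ((em : _ → _) ⁻¹' s) := by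
      ext q'
      simp only [Set.mem_preimage]
      rw [hem, hem, heh_smul, MulEquiv.apply_symm_apply]
    rw [hset]
    exact SMulInvariantMeasure.measure_preimage_smul (θW.symm g) (em.measurable hs)
  let f : C((↥(UnitaryGroup.adelic (↥(maximalRealSubfield L)) L (IsCMField.complexConj L) 1 (JW (↥(maximalRealSubfield L)) L a)) ⧸
      (UnitaryGroup.toAdelic (↥(maximalRealSubfield L)) L (IsCMField.complexConj L) 1 (JW (↥(maximalRealSubfield L)) L a)).range), ℂ) :=
    f'.comp (eh.symm : C(_, _))
  have hf : ∀ u, f (QuotientGroup.mk (θW u)) = f' (QuotientGroup.mk u) := fun u => by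
    show f' (eh.symm (QuotientGroup.mk (θW u))) = f' (QuotientGroup.mk u)
    rw [heh_symm, heq_symm_mk, MulEquiv.symm_apply_apply]
  -- the theta lifts agree pointwise
  have hlift : ∀ x : ↥(UnitaryGroup.adelic (↥(maximalRealSubfield L)) L (IsCMField.complexConj L) N (Matrix.diagonal dV')),
      (lineThetaKernelDatum L N e₁' dV' hdV' hdV'0 μ hμ a' hρ').thetaLiftFun μW' Φ' f' x =
        (lineThetaKernelDatum L N e₁ dV hdV hdV0 μ hμ a hρ).thetaLiftFun μW (R Φ') f (θV x) := fun x => by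
    rw [ThetaKernelDatum.thetaLiftFun_apply, ThetaKernelDatum.thetaLiftFun_apply, ThetaKernelDatum.thetaLift_apply,
      ThetaKernelDatum.thetaLift_apply, MeasureTheory.integral_map_equiv em]
    refine integral_congr_ae (Filter.Eventually.of_forall fun q' => ?_)
    induction q' using QuotientGroup.induction_on with
    | H u =>
      have hx : θV x⁻¹ = (θV x)⁻¹ := map_inv θV x
      beta_reduce
      rw [hem, heh, heq_mk, hf, ThetaKernelDatum.thetaKer_mk, ThetaKernelDatum.thetaKer_mk, ← ThetaKernelDatum.thetaFun_apply,
        ← ThetaKernelDatum.thetaFun_apply, ← hx,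
        thetaKernelDatum_thetaFun_eq_of_intertwiner θV θW R hΘ hR Φ' x⁻¹ u]
  have hfun : (fun y => (lineThetaKernelDatum L N e₁' dV' hdV' hdV'0 μ hμ a' hρ').thetaLiftFun μW' Φ' f' (ιA' y)) =
      fun y => (lineThetaKernelDatum L N e₁ dV hdV hdV0 μ hμ a hρ).thetaLiftFun μW (R Φ') f ((θV.comp ιA') y) :=
    funext fun y => hlift (ιA' y)
  have hq := congrArg (toQuotFun (adelicGroupData (↥(maximalRealSubfield L)) L (IsCMField.complexConj L) N H)) hfun
  have hθ : MemLp (toQuotFun (adelicGroupData (↥(maximalRealSubfield L)) L (IsCMField.complexConj L) N H) fun y =>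
      (lineThetaKernelDatum L N e₁ dV hdV hdV0 μ hμ a hρ).thetaLiftFun μW (R Φ') f ((θV.comp ιA') y)) 2 μA := hq ▸ hθ'
  have hcl : MemLp.toLp _ hθ = MemLp.toLp _ hθ' :=
    (MemLp.toLp_congr hθ' hθ (Filter.Eventually.of_forall fun q => congrFun hq q)).symm
  exact ⟨hρ, μW, hfin, hinv, f, R Φ', hθ, hcl ▸ hmem, hcl ▸ hne⟩

end Seam

end Literature.NumberTheory.Automorphic.Liu2021

end
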